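import Literature.MathematicalPhysics.QuantumFieldTheory.BalabanImbrieJaffe1984to88.BIJ85Ineq722DeltaA

/-!
# `BalabanImbrieJaffe1984to88.BIJ85Ineq722AllTori` — T. Bałaban, J. Imbrie, A. Jaffe, *Renormalization of the Higgs model: minimizers,
propagators and the stability of mean field theory*, Commun. Math. Phys. **97** (1985) 299–329 [BalabanImbrieJaffe1985], Sect. 7.2
p. 325, **(7.2.2) UNIFORMLY OVER ALL TORI AND ALL SCALES** — the typed row `BIJ85Sect7Statements.KernelData.Ineq722` for ANY SEQUENCE
`n ↦ (P_n, k_n)` of tori `Setup.Params` of one dimension `d` and scales `k_n ≤ m_n + K_n`, for the printed operator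
`H_k = G_kQ_k^*(Q_kG_kQ_k^*)⁻¹`, `G_k = Δ_a⁻¹` of [6I] = [Balaban1984PropagatorsI] (p09's `deltaAData`), GIVEN [6I] Proposition 1.2 at
constants uniform over the sequence — in particular given `B5.Prop12Printed` over the ALL-TORI family of p09's carriers.

statement-level skeleton of published theorems with citation tags; proofs where landed; nothing here is a claim about the Yang–Mills mass gap

PDF held: `paper:balaban1985-cmp97-bij-higgs-minimizers` (p. 325 = PDF 27) and `paper:balaban1984-cmp95-propagators-rt-i` (Prop. 1.2 pp.
35–36 = PDF 19–20); text layers re-read this session.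

CITATION HEADER (lean-in-tree rule).  Part of the lit-balaban TYPED SKELETON (HOME `run/shared/lean/pub/lit-balaban/`), Phase-2 proof
seat p16 gen 7; row **C1.Eq7.2.1-7.2.2** (owner r15, referee ref-5); companion of `BIJ85Prop12PerTower` (this seat, p304326: the
PER-TOWER `∃`-encodings are finite bookkeeping) and of the bridge «`B5.Prop12Printed` (p09 family) ← `B5Prop12GHolds.prop12_famG_printed`»
held by seat p30 gen 9.

THE PRINTED TEXT (verbatim, p. 325 [PDF 27]): *"The kernel H_{k,μν}(x,y) and its gradient decay exponentially. In particular there exists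
δ > 0 and for 0 ≤ α < 1 a constant M = M(α) < ∞ such that for |x − x′| ≤ 1, |H_{k,μν}(x,y)| + |∇H_{k,μν}(x,y)| +
|x − x′|^{−α}|∇H_{k,μν}(x,y) − ∇H_{k,μν}(x′,y)| ≤ Me^{−δ|x−y|}. (7.2.2) This inequality is a consequence of Proposition 1.2 and the
representation (1.103) of [6I]."*  [6I] p. 35: *"with the constant O(1) depending on d only"*, p. 33: *"independent of k, T_η"*: the
printed constants are uniform in the scale AND in the torus.

WHAT IS PROVED (theorems only; no `def`, no Prop-valued fact).
* `hyps_torus_deltaA_dim`: the structural inputs of p09's derivation for the printed data at constants depending on `(d, a)` only —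
  `(torusRep P k (deltaAData hk a)).Hyps (gam0 d/(4d + a)) 1 1 1 (t ↦ (2(1 + d/t))^d)` for EVERY torus `P` with `P.d = d`, every
  `k ≤ m + K` (p09's `torusHyps_deltaA` + `hyps_torus`, with the `P.d`-dependence made explicit).
* **`ineq722_deltaA_seq`**: for ANY sequence `n ↦ (P_n, k_n)` with `P_n.d = d`, `k_n ≤ m_n + K_n`, and any `0 < a`, the three displayed
  members of [6I] Prop. 1.2 at constants `(C, C_α, δ₀)` THE SAME FOR ALL `n` give `KernelData.Ineq722 (n ↦ torusKernelData (P_n) (k_n)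
  (deltaAData …))` — one `δ`, one `M(α)` for the whole sequence (p09's `ineq722_of_family` instantiated across tori instead of across the
  levels of one torus).
* **`ineq722_deltaA_seq_of_prop12Printed`**: the same GIVEN `B5.Prop12Printed` for p09's carriers over the ALL-TORI index
  `{(P, k) // P.d = d ∧ P.L = L ∧ 1 ≤ k ∧ k ≤ m + K}` (the faithful form of «[6I] Prop. 1.2 by its tree name»: constants before the torus) —
  for every sequence of members of that index.  `ineq722_deltaA_lev_of_prop12Printed_allTori`: p09's per-tower shape (`lev`, scales `≥ 1`)
  as the constant-torus special case.
HONEST SCOPE.  Pure re-indexing of p09's abstract derivation (`BIJ85Ineq722ProofPart2.ineq722_of_family`, constants `rate722 d …`,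
`M722 d … α`); the analytic inputs other than Prop. 1.2 are p09's theorems (`torusHyps_deltaA`: `G_k` symmetric, (1.100) with
`γ_E = γ₀/(4d + a)`, the (1.18) averaging kernel).  The all-tori `B5.Prop12Printed` hypothesis of the last two theorems is NOT proved here
(it is the export the p09 ↔ r02 bridge should provide from `B5Prop12GHolds.prop12_famG_printed`; see GAPS G-C1-07); scales `k ≥ 1`
only there (level `0` is outside print and outside r02's `TopIdx`).  Unit `lit-balaban-p16` (literature-prover-lit-balaban-p16-g7-0), 2026-08-21.
-/

namespace Literature.MathematicalPhysics.QuantumFieldTheory.BalabanImbrieJaffe1984to88.BIJ85Ineq722AllTori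

open Literature.MathematicalPhysics.QuantumFieldTheory.Balaban1983to89
open scoped BigOperators Matrix
open BIJ85Ineq722Proof BIJ85Ineq722Proof.Rep103 BIJ85Ineq722ProofPart2 BIJ85Sect7Statements BIJ85Ineq722Torus BIJ85Ineq722DeltaA

noncomputable section

/-! ## §1  The structural inputs at constants depending on `(d, a)` only -/

/-- transport of p09's hypothesis bundle along equal constants. [folklore] -/
private theorem hyps_congr {R : Rep103} {γ γ' q₀ q₁ rQ : ℝ} {KY KY' : ℝ → ℝ} (hγ : γ = γ') (hK : KY = KY')
    (h : R.Hyps γ q₀ q₁ rQ KY) : R.Hyps γ' q₀ q₁ rQ KY' := by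
  subst hγ; subst hK; exact h

/-- `|Dir| = d` for a torus of dimension `d`. [folklore] -/
private theorem card_dir_eq {P : Params} {k : ℕ} {D : TorusData P k} {d : ℕ} (hPd : P.d = d) :
    Fintype.card (torusRep P k D).Dir = d := by
  rw [← hPd]; exact Fintype.card_fin P.d

/-- **The structural inputs of the derivation of (7.2.2) for the printed data, at constants depending on `(d, a)` only**: for every torus
`P` of dimension `d`, every scale `k ≤ m + K`, every `a > 0`, p09's `Hyps` hold for `torusRep P k (deltaAData hk a)` with
`γ₁ = γ₀/(4d + a)` ((1.100)–(1.101)), `q₀ = q₁ = r_Q = 1` ((1.18)) and the lattice-sum profile `KY(t) = (2(1 + d/t))^d` — none of them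
depending on the volume or on `k`. [cite: Balaban1984PropagatorsI, Prop. 1.1 p.33, (1.100) p.34, (1.18) p.20] -/
theorem hyps_torus_deltaA_dim {P : Params} {k d : ℕ} (hPd : P.d = d) (hk : k ≤ P.m + P.K) {a : ℝ} (ha : 0 < a) :
    (torusRep P k (deltaAData hk a)).Hyps (T4GaugeActionRate.gam0 d / (4 * d + a)) 1 1 1
      (fun t : ℝ => (2 * (1 + (d : ℝ) / t)) ^ d) := by
  refine hyps_congr ?_ ?_ (hyps_torus hk (torusHyps_deltaA hk ha))
  · rw [hPd]
  · funext t
    simp [KYd, hPd]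

/-! ## §2  (7.2.2) for any sequence of tori and scales -/

/-- **(7.2.2) UNIFORMLY OVER ANY SEQUENCE OF TORI AND SCALES** (row C1.Eq7.2.1-7.2.2 `KernelData.Ineq722`): for `n ↦ (P_n, k_n)` with all
`P_n.d = d`, `k_n ≤ m_n + K_n`, the printed `H_k = G_kQ_k^*(Q_kG_kQ_k^*)⁻¹`, `G_k = Δ_a⁻¹` (`deltaAData`), `a > 0`: the three displayed
members of [6I] Prop. 1.2 at constants `(C, C_α, δ₀)` common to all `n` give ONE `δ > 0` and, for each `0 ≤ α < 1`, ONE `M(α)` for the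
whole sequence — p. 325 «This inequality is a consequence of Proposition 1.2 and the representation (1.103) of [6I]», with the printed
uniformity in the torus. [cite: BalabanImbrieJaffe1985, (7.2.2) p.325] -/
theorem ineq722_deltaA_seq {d : ℕ} (Pn : ℕ → Params) (hPd : ∀ n, (Pn n).d = d) (kn : ℕ → ℕ)
    (hkn : ∀ n, kn n ≤ (Pn n).m + (Pn n).K) {a : ℝ} (ha : 0 < a) (BondU : ℕ → Type)
    (distEB : (n : ℕ) → Balaban1983to89.Site (Pn n) 0 → BondU n → ℝ)
    (Cker : (n : ℕ) → Fin (Pn n).d → Fin (Pn n).d → Balaban1983to89.Site (Pn n) (kn n) → Balaban1983to89.Site (Pn n) (kn n) → ℝ)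
    (Dker : (n : ℕ) → Balaban1983to89.Site (Pn n) 0 → BondU n → ℝ) {C δ₀ : ℝ} {Cα : ℝ → ℝ}
    (h12 : ∀ n, (torusRep (Pn n) (kn n) (deltaAData (hkn n) a)).Prop12Hyps C Cα δ₀) :
    KernelData.Ineq722
      (fun n => torusKernelData (Pn n) (kn n) (deltaAData (hkn n) a) (BondU n) (distEB n) (Cker n) (Dker n)) :=
  ineq722_of_family (fun n => torusRep (Pn n) (kn n) (deltaAData (hkn n) a)) BondU (fun n => distEU (Pn n) (kn n)) distEB Cker
    Dker (nD := d) (fun n => card_dir_eq (hPd n)) (fun n => hyps_torus_deltaA_dim (hPd n) (hkn n) ha) h12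
    (fun n => cutoffHyps_torus (hkn n)) (fun n x y => distEU_le (hkn n) x y) (fun _ x x' hne => dS_pos x x' hne)

/-! ## §3  The same given `B5.Prop12Printed` over the ALL-TORI family of p09's carriers -/

/-- **(7.2.2) FOR EVERY SEQUENCE OF TORI GIVEN [6I] PROP. 1.2 BY ITS TREE NAME OVER ALL TORI**: if `B5.Prop12Printed` holds for p09's
carriers indexed by ALL pairs `(P, k)` with `P.d = d`, `P.L = L`, `1 ≤ k ≤ m + K` (constants chosen before the torus — the faithful form
of Prop. 1.2's «depending on d only … independent of k, T_η»), then for every sequence of such pairs `KernelData.Ineq722` holds with one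
`δ`, one `M(α)`. [cite: BalabanImbrieJaffe1985, (7.2.2) p.325] -/
theorem ineq722_deltaA_seq_of_prop12Printed {d L : ℕ} {a : ℝ} (ha : 0 < a)
    (h12 : B5.Prop12Printed (fun i : {x : Params × ℕ // x.1.d = d ∧ x.1.L = L ∧ 1 ≤ x.2 ∧ x.2 ≤ x.1.m + x.1.K} =>
      settingOf (torusRep i.1.1 i.1.2 (deltaAData i.2.2.2.2 a)) i.1.2))
    (Pn : ℕ → Params) (hPd : ∀ n, (Pn n).d = d) (hPL : ∀ n, (Pn n).L = L) (kn : ℕ → ℕ) (hk1 : ∀ n, 1 ≤ kn n)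
    (hkn : ∀ n, kn n ≤ (Pn n).m + (Pn n).K) (BondU : ℕ → Type)
    (distEB : (n : ℕ) → Balaban1983to89.Site (Pn n) 0 → BondU n → ℝ)
    (Cker : (n : ℕ) → Fin (Pn n).d → Fin (Pn n).d → Balaban1983to89.Site (Pn n) (kn n) → Balaban1983to89.Site (Pn n) (kn n) → ℝ)
    (Dker : (n : ℕ) → Balaban1983to89.Site (Pn n) 0 → BondU n → ℝ) :
    KernelData.Ineq722
      (fun n => torusKernelData (Pn n) (kn n) (deltaAData (hkn n) a) (BondU n) (distEB n) (Cker n) (Dker n)) := by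
  obtain ⟨δ₀, C, Cα, Cε, Cαε, hδ₀, hC, hall⟩ := h12
  refine ineq722_deltaA_seq Pn hPd kn hkn ha BondU distEB Cker Dker (C := C) (δ₀ := δ₀) (Cα := Cα) fun n => ?_
  exact prop12Hyps_of_ineq110_114 hC.le hδ₀ (hall ⟨(Pn n, kn n), hPd n, hPL n, hk1 n, hkn n⟩)

/-- the constant-torus special case: p09's per-tower shape for any indexing `lev` of the scales `1 ≤ lev k ≤ m + K` of ONE torus, from the
all-tori hypothesis (so that the per-tower statement inherits volume-independent constants inside the proof). [cite: BalabanImbrieJaffe1985, (7.2.2) p.325] -/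
theorem ineq722_deltaA_lev_of_prop12Printed_allTori {d L : ℕ} {a : ℝ} (ha : 0 < a)
    (h12 : B5.Prop12Printed (fun i : {x : Params × ℕ // x.1.d = d ∧ x.1.L = L ∧ 1 ≤ x.2 ∧ x.2 ≤ x.1.m + x.1.K} =>
      settingOf (torusRep i.1.1 i.1.2 (deltaAData i.2.2.2.2 a)) i.1.2))
    {P : Params} (hPd : P.d = d) (hPL : P.L = L) (lev : ℕ → ℕ) (hlev1 : ∀ k, 1 ≤ lev k) (hlev : ∀ k, lev k ≤ P.m + P.K)
    (BondU : ℕ → Type) (distEB : (k : ℕ) → Balaban1983to89.Site P 0 → BondU k → ℝ)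
    (Cker : (k : ℕ) → Fin P.d → Fin P.d → Balaban1983to89.Site P (lev k) → Balaban1983to89.Site P (lev k) → ℝ)
    (Dker : (k : ℕ) → Balaban1983to89.Site P 0 → BondU k → ℝ) :
    KernelData.Ineq722 (fun k => torusKernelData P (lev k) (deltaAData (hlev k) a) (BondU k) (distEB k) (Cker k) (Dker k)) :=
  ineq722_deltaA_seq_of_prop12Printed ha h12 (fun _ => P) (fun _ => hPd) (fun _ => hPL) lev hlev1 hlev BondU distEB Cker Dker

end

end Literature.MathematicalPhysics.QuantumFieldTheory.BalabanImbrieJaffe1984to88.BIJ85Ineq722AllTori
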